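import Summits.Ventures.PercRepro.GenQTraceHypAddTwo
import Summits.Ventures.PercRepro.GenQNearEndPiecesGen

/-!
# PercRepro — the trace layer's near end from two pieces (night-4, gen 10, part B of the trace functional)

On a COLOOP-FREE rank-`(q + 1)` set `G` with a rank-`q` flat `K`, `|G ∖ K| ≤ 2` forces `|G ∖ K| = 2` and
`rk(K ∩ G) = q` (a smaller trace or a one-point complement makes an outside point a coloop), so the level-`(q + 2)`
trace sum at type `t` on `G` is bounded below by `traceHypAddTwoProfile` of the trace — the trace layer's near end at
branch depth `2` is «branch certificate ∧ the trace functional ≥ 0» (`traceSum_succ_of_two_pieces`), the exact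
analogue of `jq_succ_of_two_pieces_type`.  At `(9, 7)`: `q = 5`, `t = 6` — the shape «rank-`5` trace + 2 points» of
`TraceSixResidue` at corank `|G| − 6`.
-/
namespace PercRepro.GenQ

open Finset ThmH SixFour PerFlat Star

variable {α : Type*} [DecidableEq α] {M : Matroid α} [M.Finite]

/-- **A two-point complement of a rank-`q` flat trace, on a coloop-free `G`**: the trace is the whole rank and the
two outside points are off its closure, so the trace functional bounds the trace sum. -/
theorem traceSum_nonneg_of_sdiff_le_two {q t : ℕ} {G H : Finset α} (hq : 1 ≤ q) (ht : t ≤ q + 2)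
    (htwo : ∀ (τ : Finset α) (a a' : α), τ ⊆ gr M → M.eRk (τ : Set α) = (q : ℕ∞) → τ.card + 2 = G.card →
      a ∈ gr M → a' ∈ gr M → a ≠ a' → a ∉ τ → a' ∉ τ → a ∉ M.closure (τ : Set α) → a' ∉ M.closure (τ : Set α) →
      M.eRk ((insert a (insert a' τ) : Finset α) : Set α) = (q : ℕ∞) + 1 → 0 ≤ traceHypAddTwoProfile M τ a a' q t)
    (hG : G ⊆ gr M) (hrG : M.eRk (G : Set α) = ((q + 1 : ℕ) : ℕ∞)) (hmG : mTr M G = 0)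
    (hH : H ∈ flatsQ M q) (hX : (G \ H).card ≤ 2) : 0 ≤ ∑ B ∈ Rq M G (q + 1), ((((q + 1 + 1 : ℕ) : ℚ) + 2 - t) * (1 / (2 + (mTr M B : ℚ))) - ((((q + 1 + 1 : ℕ) : ℚ) + 2) / (((q + 1 + 1 : ℕ) : ℚ) + 1)) * dem M G t B) := by
  -- the rank of the trace
  obtain ⟨k, hk⟩ := exists_eRk_eq_nat (M := M) (H ∩ G)
  have hkq : k ≤ q := by
    have := PercRepro.Night4.eRk_inter_le_of_flatsQ (G := G) hH
    rw [hk] at this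
    exact_mod_cast this
  have hcoloop : ∀ x ∈ G, x ∉ M.closure ((G.erase x : Finset α) : Set α) → False := by
    intro x hx hxcl
    have : x ∈ coloopsOf M G := mem_coloopsOf.2 ⟨hx, hxcl⟩
    have h1 : 0 < mTr M G := by
      unfold mTr
      exact Finset.card_pos.2 ⟨x, this⟩
    omega
  -- `rk(H ∩ G) ≤ q − 1` is impossible: then `|G ∖ H| = 2` and each outside point is a coloop of `G`
  by_cases hk5 : k + 1 ≤ q
  · exfalso
    have hXpos : (G \ H).card ≠ 0 := by
      intro h0
      rw [Finset.card_eq_zero, Finset.sdiff_eq_empty_iff_subset] at h0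
      have hsub : G ⊆ H ∩ G := fun y hy => Finset.mem_inter.2 ⟨h0 hy, hy⟩
      have h1 := M.eRk_mono (Finset.coe_subset.2 hsub)
      rw [hrG, hk] at h1
      have : (q + 1 : ℕ) ≤ k := by exact_mod_cast h1
      omega
    obtain ⟨x, hx⟩ : ∃ x, x ∈ G \ H := Finset.card_pos.1 (Nat.pos_of_ne_zero hXpos)
    have hxG : x ∈ G := (Finset.mem_sdiff.1 hx).1
    apply hcoloop x hxG
    intro hxcl
    -- `G ∖ x ⊆ (H ∩ G) ∪ ((G ∖ H).erase x)`, so `rk(G ∖ x) ≤ k + 1 ≤ q < q + 1 = rk G`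
    have hsub : G.erase x ⊆ (H ∩ G) ∪ ((G \ H).erase x) := by
      intro y hy
      rw [Finset.mem_erase] at hy
      rw [Finset.mem_union, Finset.mem_inter, Finset.mem_erase, Finset.mem_sdiff]
      by_cases hyH : y ∈ H
      · exact Or.inl ⟨hyH, hy.2⟩
      · exact Or.inr ⟨hy.1, hy.2, hyH⟩
    have hcardY : ((G \ H).erase x).card ≤ 1 := by
      have h1 := Finset.card_erase_of_mem hx
      omega
    have h2 : M.eRk ((G.erase x : Finset α) : Set α) ≤ M.eRk ((H ∩ G : Finset α) : Set α) + (((G \ H).erase x).card : ℕ∞) :=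
      (M.eRk_mono (Finset.coe_subset.2 hsub)).trans (eRk_union_le_eRk_add_card _ _)
    have h3 : M.eRk (G : Set α) ≤ M.eRk ((G.erase x : Finset α) : Set α) := by
      rw [← M.eRk_closure_eq ((G.erase x : Finset α) : Set α)]
      apply M.eRk_mono
      intro y hy
      by_cases hyx : y = x
      · rw [hyx]; exact hxcl
      · exact M.subset_closure_of_subset' (subset_refl _) (by
          rw [← coe_gr M]
          exact_mod_cast (show G.erase x ⊆ gr M from (Finset.erase_subset x G).trans hG)) (by
          rw [Finset.mem_coe, Finset.mem_erase]; exact ⟨hyx, by exact_mod_cast hy⟩)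
    have h4 : M.eRk (G : Set α) ≤ (k : ℕ∞) + 1 := by
      calc M.eRk (G : Set α) ≤ M.eRk ((G.erase x : Finset α) : Set α) := h3
        _ ≤ M.eRk ((H ∩ G : Finset α) : Set α) + (((G \ H).erase x).card : ℕ∞) := h2
        _ ≤ (k : ℕ∞) + 1 := by rw [hk]; exact add_le_add le_rfl (by exact_mod_cast hcardY)
    rw [hrG] at h4
    have h5 : (q + 1 : ℕ) ≤ k + 1 := by exact_mod_cast h4
    omega
  have hkq' : k = q := by omega
  have hrτ : M.eRk ((H ∩ G : Finset α) : Set α) = (q : ℕ∞) := by rw [hk, hkq']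
  have hτG : H ∩ G ⊆ G := Finset.inter_subset_right
  have hτgr : H ∩ G ⊆ gr M := hτG.trans hG
  -- `G = (H ∩ G) ∪ (G ∖ H)`, `|G ∖ H| ∈ {1, 2}`
  have hGeq : G = (H ∩ G) ∪ (G \ H) := by
    ext x
    simp only [Finset.mem_union, Finset.mem_inter, Finset.mem_sdiff]
    tauto
  have hXne : (G \ H).card ≠ 0 := by
    intro h0
    rw [Finset.card_eq_zero] at h0
    rw [hGeq, h0, Finset.union_empty, hrτ] at hrG
    have : (q : ℕ) = q + 1 := by exact_mod_cast hrG
    omega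
  have hrank_absurd : ∀ {h : ((q + 1 : ℕ) : ℕ∞) ≤ (q : ℕ∞)}, False := by
    intro h
    have : (q + 1 : ℕ) ≤ q := by exact_mod_cast h
    omega
  rcases (show (G \ H).card = 1 ∨ (G \ H).card = 2 by omega) with h1 | h2
  · -- `|G ∖ H| = 1`: the point outside `H` is a coloop of `G` — impossible for a coloop-free `G`
    obtain ⟨a, ha⟩ := Finset.card_eq_one.1 h1
    have hmem : ∀ x, x ∈ G \ H ↔ x = a := by
      intro x; rw [ha, Finset.mem_singleton]
    have haG : a ∈ G := (Finset.mem_sdiff.1 ((hmem a).2 rfl)).1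
    have haH : a ∉ H := (Finset.mem_sdiff.1 ((hmem a).2 rfl)).2
    have haτ : a ∉ H ∩ G := fun h => haH (Finset.mem_inter.1 h).1
    have herase : G.erase a = H ∩ G := by
      ext x
      rw [Finset.mem_erase, Finset.mem_inter]
      constructor
      · rintro ⟨hxa, hxG⟩
        by_cases hxH : x ∈ H
        · exact ⟨hxH, hxG⟩
        · exact absurd ((hmem x).1 (Finset.mem_sdiff.2 ⟨hxG, hxH⟩)) hxa
      · rintro ⟨hxH, hxG⟩
        exact ⟨fun h => haτ (h ▸ Finset.mem_inter.2 ⟨hxH, hxG⟩), hxG⟩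
    exfalso
    apply hcoloop a haG
    rw [herase]
    intro hacl
    have hGeq' : G = insert a (H ∩ G) := by
      ext x
      rw [Finset.mem_insert, Finset.mem_inter]
      constructor
      · intro hxG
        by_cases hxH : x ∈ H
        · exact Or.inr ⟨hxH, hxG⟩
        · exact Or.inl ((hmem x).1 (Finset.mem_sdiff.2 ⟨hxG, hxH⟩))
      · rintro (rfl | ⟨_, hxG⟩)
        · exact haG
        · exact hxG
    have h := eRk_insert_le_of_mem_closure hτgr hacl
    rw [← hGeq', hrG, hrτ] at h
    exact hrank_absurd (h := h)
  · -- (β₂): `G = insert a (insert a' τ)`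
    obtain ⟨a, a', hne, ha⟩ := Finset.card_eq_two.1 h2
    have hmem : ∀ x, x ∈ G \ H ↔ x = a ∨ x = a' := by
      intro x; rw [ha, Finset.mem_insert, Finset.mem_singleton]
    have haG : a ∈ G := (Finset.mem_sdiff.1 ((hmem a).2 (Or.inl rfl))).1
    have ha'G : a' ∈ G := (Finset.mem_sdiff.1 ((hmem a').2 (Or.inr rfl))).1
    have haH : a ∉ H := (Finset.mem_sdiff.1 ((hmem a).2 (Or.inl rfl))).2
    have ha'H : a' ∉ H := (Finset.mem_sdiff.1 ((hmem a').2 (Or.inr rfl))).2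
    have haτ : a ∉ H ∩ G := fun h => haH (Finset.mem_inter.1 h).1
    have ha'τ : a' ∉ H ∩ G := fun h => ha'H (Finset.mem_inter.1 h).1
    have hshape : ∀ x y : α, (∀ z, z ∈ G \ H ↔ z = x ∨ z = y) → x ∈ G → y ∈ G →
        G = insert x (insert y (H ∩ G)) := by
      intro x y hxy hxG hyG
      ext z
      rw [Finset.mem_insert, Finset.mem_insert, Finset.mem_inter]
      constructor
      · intro hzG
        by_cases hzH : z ∈ H
        · exact Or.inr (Or.inr ⟨hzH, hzG⟩)
        · rcases (hxy z).1 (Finset.mem_sdiff.2 ⟨hzG, hzH⟩) with rfl | rfl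
          · exact Or.inl rfl
          · exact Or.inr (Or.inl rfl)
      · rintro (rfl | rfl | ⟨_, hzG⟩)
        · exact hxG
        · exact hyG
        · exact hzG
    have herase : ∀ x y : α, x ≠ y → (∀ z, z ∈ G \ H ↔ z = x ∨ z = y) → x ∈ G → y ∉ H ∩ G →
        G.erase y = insert x (H ∩ G) := by
      intro x y hxy hxyG hxG hyτ
      ext z
      rw [Finset.mem_erase, Finset.mem_insert, Finset.mem_inter]
      constructor
      · rintro ⟨hzy, hzG⟩
        by_cases hzH : z ∈ H
        · exact Or.inr ⟨hzH, hzG⟩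
        · rcases (hxyG z).1 (Finset.mem_sdiff.2 ⟨hzG, hzH⟩) with rfl | rfl
          · exact Or.inl rfl
          · exact absurd rfl hzy
      · rintro (rfl | ⟨hzH, hzG⟩)
        · exact ⟨hxy, hxG⟩
        · exact ⟨fun h => hyτ (h ▸ Finset.mem_inter.2 ⟨hzH, hzG⟩), hzG⟩
    have hGeq' : G = insert a (insert a' (H ∩ G)) := hshape a a' hmem haG ha'G
    have hcl : ∀ x y : α, x ≠ y → (∀ z, z ∈ G \ H ↔ z = x ∨ z = y) → x ∈ G → y ∈ G → x ∉ H ∩ G → y ∉ H ∩ G →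
        x ∉ M.closure ((H ∩ G : Finset α) : Set α) := by
      intro x y hxy hxyG hxG hyG hxτ hyτ hxcl
      have hGxy : G = insert x (insert y (H ∩ G)) := hshape x y hxyG hxG hyG
      have hycl : y ∉ M.closure ((H ∩ G : Finset α) : Set α) := by
        intro hycl
        have e2 := eRk_insert_le_of_mem_closure hτgr hycl
        have e1 := eRk_insert_le_of_mem_closure (τ := insert y (H ∩ G)) (a := x)
          (Finset.insert_subset_iff.2 ⟨hG hyG, hτgr⟩)
          (M.closure_subset_closure (Finset.coe_subset.2 (Finset.subset_insert y (H ∩ G))) hxcl)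
        have h1 := e1.trans e2
        rw [← hGxy, hrG, hrτ] at h1
        exact hrank_absurd (h := h1)
      apply hcoloop y hyG
      rw [herase x y hxy hxyG hxG hyτ]
      intro hy
      apply hycl
      have hsub : ((insert x (H ∩ G) : Finset α) : Set α) ⊆ M.closure ((H ∩ G : Finset α) : Set α) := by
        rw [Finset.coe_insert]
        exact Set.insert_subset hxcl (M.subset_closure _ (by rw [← coe_gr M]; exact_mod_cast hτgr))
      exact M.closure_subset_closure_of_subset_closure hsub hy
    have hacl : a ∉ M.closure ((H ∩ G : Finset α) : Set α) := hcl a a' hne hmem haG ha'G haτ ha'τ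
    have ha'cl : a' ∉ M.closure ((H ∩ G : Finset α) : Set α) :=
      hcl a' a (Ne.symm hne) (fun z => by rw [hmem z]; exact or_comm) ha'G haG ha'τ haτ
    have hcardτ : (H ∩ G).card + 2 = G.card := by
      have hc := congrArg Finset.card hGeq'
      rw [Finset.card_insert_of_notMem (by
        rw [Finset.mem_insert]
        exact fun h => h.elim hne haτ), Finset.card_insert_of_notMem ha'τ] at hc
      omega
    have hrG' : M.eRk ((insert a (insert a' (H ∩ G)) : Finset α) : Set α) = (q : ℕ∞) + 1 := by
      rw [← hGeq', hrG]; push_cast; rfl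
    rw [hGeq']
    have key := traceSum_hyp_add_two_ge_profile (M := M) (τ := H ∩ G) (q := q) (t := t) (hG haG) (hG ha'G) hne haτ ha'τ
      hacl ha'cl hrτ hrG' hq ht
    exact le_trans (htwo (H ∩ G) a a' hτgr hrτ hcardτ (hG haG) (hG ha'G) hne haτ ha'τ hacl ha'cl hrG') key


/-- **The trace layer's near end from TWO pieces** (branch depth `2`, every `q ≥ 1`, every type `t ≤ q + 2`): the
BRANCH certificate and the trace functional on the rank-`q` sets of `n − 2` points give the level-`(q + 2)` trace sum
at type `t` on every coloop-free rank-`(q + 1)` set of `n` points. -/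
theorem traceSum_succ_of_two_pieces {q n t : ℕ} (hq : 1 ≤ q) (ht : t ≤ q + 2)
    (hcert : ∀ G : Finset α, G ⊆ gr M → M.eRk (G : Set α) = ((q + 1 : ℕ) : ℕ∞) → G.card = n → mTr M G = 0 →
      (∀ H ∈ flatsQ M q, (H ∩ G).card + 2 < G.card) → 0 ≤ ∑ B ∈ Rq M G (q + 1), ((((q + 1 + 1 : ℕ) : ℚ) + 2 - t) * (1 / (2 + (mTr M B : ℚ))) - ((((q + 1 + 1 : ℕ) : ℚ) + 2) / (((q + 1 + 1 : ℕ) : ℚ) + 1)) * dem M G t B))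
    (htwo : ∀ (τ : Finset α) (a a' : α), τ ⊆ gr M → M.eRk (τ : Set α) = (q : ℕ∞) → τ.card + 2 = n →
      a ∈ gr M → a' ∈ gr M → a ≠ a' → a ∉ τ → a' ∉ τ → a ∉ M.closure (τ : Set α) → a' ∉ M.closure (τ : Set α) →
      M.eRk ((insert a (insert a' τ) : Finset α) : Set α) = (q : ℕ∞) + 1 → 0 ≤ traceHypAddTwoProfile M τ a a' q t)
    (G : Finset α) (hG : G ⊆ gr M) (hrG : M.eRk (G : Set α) = ((q + 1 : ℕ) : ℕ∞)) (hcard : G.card = n)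
    (hmG : mTr M G = 0) : 0 ≤ ∑ B ∈ Rq M G (q + 1), ((((q + 1 + 1 : ℕ) : ℚ) + 2 - t) * (1 / (2 + (mTr M B : ℚ))) - ((((q + 1 + 1 : ℕ) : ℚ) + 2) / (((q + 1 + 1 : ℕ) : ℚ) + 1)) * dem M G t B) := by
  by_cases hbig : ∀ H ∈ flatsQ M q, (H ∩ G).card + 2 < G.card
  · exact hcert G hG hrG hcard hmG hbig
  obtain ⟨H, hH, hle⟩ : ∃ H ∈ flatsQ M q, G.card ≤ (H ∩ G).card + 2 := by
    by_contra h
    exact hbig (fun H hH => by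
      by_contra h2
      exact h ⟨H, hH, by omega⟩)
  have hX : (G \ H).card ≤ 2 := by
    rw [PercRepro.Night4.card_sdiff_eq_card_sub_card_inter]
    omega
  exact traceSum_nonneg_of_sdiff_le_two hq ht
    (fun τ a a' hτ hrτ hcτ => htwo τ a a' hτ hrτ (hcard ▸ hcτ)) hG hrG hmG hH hX

/-- **The trace layer from the branch, the trace functional and the deeper shapes**: at branch depth `t₀ ≥ 2`, the
branch certificate, the trace functional on the rank-`q` sets of `n − 2` points (the shape «trace + 2 points») and the
shapes «trace + j points» for `3 ≤ j ≤ t₀` give the level-`(q + 2)` trace sum at type `t` on every coloop-free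
rank-`(q + 1)` set of `n` points. -/
theorem traceSum_succ_of_branch_functional_and_shapes {q n t t₀ : ℕ} (hq : 1 ≤ q) (ht : t ≤ q + 2)
    (hcert : ∀ G : Finset α, G ⊆ gr M → M.eRk (G : Set α) = ((q + 1 : ℕ) : ℕ∞) → G.card = n → mTr M G = 0 →
      (∀ H ∈ flatsQ M q, (H ∩ G).card + t₀ < G.card) → 0 ≤ ∑ B ∈ Rq M G (q + 1), ((((q + 1 + 1 : ℕ) : ℚ) + 2 - t) * (1 / (2 + (mTr M B : ℚ))) - ((((q + 1 + 1 : ℕ) : ℚ) + 2) / (((q + 1 + 1 : ℕ) : ℚ) + 1)) * dem M G t B))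
    (htwo : ∀ (τ : Finset α) (a a' : α), τ ⊆ gr M → M.eRk (τ : Set α) = (q : ℕ∞) → τ.card + 2 = n →
      a ∈ gr M → a' ∈ gr M → a ≠ a' → a ∉ τ → a' ∉ τ → a ∉ M.closure (τ : Set α) → a' ∉ M.closure (τ : Set α) →
      M.eRk ((insert a (insert a' τ) : Finset α) : Set α) = (q : ℕ∞) + 1 → 0 ≤ traceHypAddTwoProfile M τ a a' q t)
    (hshape : ∀ (G H : Finset α), G ⊆ gr M → M.eRk (G : Set α) = ((q + 1 : ℕ) : ℕ∞) → G.card = n → mTr M G = 0 →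
      H ∈ flatsQ M q → 3 ≤ (G \ H).card → (G \ H).card ≤ t₀ → 0 ≤ ∑ B ∈ Rq M G (q + 1), ((((q + 1 + 1 : ℕ) : ℚ) + 2 - t) * (1 / (2 + (mTr M B : ℚ))) - ((((q + 1 + 1 : ℕ) : ℚ) + 2) / (((q + 1 + 1 : ℕ) : ℚ) + 1)) * dem M G t B))
    (G : Finset α) (hG : G ⊆ gr M) (hrG : M.eRk (G : Set α) = ((q + 1 : ℕ) : ℕ∞)) (hcard : G.card = n)
    (hmG : mTr M G = 0) : 0 ≤ ∑ B ∈ Rq M G (q + 1), ((((q + 1 + 1 : ℕ) : ℚ) + 2 - t) * (1 / (2 + (mTr M B : ℚ))) - ((((q + 1 + 1 : ℕ) : ℚ) + 2) / (((q + 1 + 1 : ℕ) : ℚ) + 1)) * dem M G t B) := by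
  by_cases hbig : ∀ H ∈ flatsQ M q, (H ∩ G).card + t₀ < G.card
  · exact hcert G hG hrG hcard hmG hbig
  obtain ⟨H, hH, hle⟩ : ∃ H ∈ flatsQ M q, G.card ≤ (H ∩ G).card + t₀ := by
    by_contra h
    exact hbig (fun H hH => by
      by_contra h2
      exact h ⟨H, hH, by omega⟩)
  have hX : (G \ H).card ≤ t₀ := by
    rw [PercRepro.Night4.card_sdiff_eq_card_sub_card_inter]
    omega
  by_cases h3 : 3 ≤ (G \ H).card
  · exact hshape G H hG hrG hcard hmG hH h3 hX
  exact traceSum_nonneg_of_sdiff_le_two hq ht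
    (fun τ a a' hτ hrτ hcτ => htwo τ a a' hτ hrτ (hcard ▸ hcτ)) hG hrG hmG hH (by omega)

/-- The `(9, 7)` instance (`q = 5`, type `6`): the trace layer's near end at branch depth `2` is the branch certificate
and the trace functional on the rank-`5` traces of `n − 2` points. -/
theorem traceSum_six_of_two_pieces {n : ℕ}
    (hcert : ∀ G : Finset α, G ⊆ gr M → M.eRk (G : Set α) = ((5 + 1 : ℕ) : ℕ∞) → G.card = n → mTr M G = 0 →
      (∀ H ∈ flatsQ M 5, (H ∩ G).card + 2 < G.card) →
      0 ≤ ∑ B ∈ Rq M G (5 + 1), ((((5 + 1 + 1 : ℕ) : ℚ) + 2 - ((6 : ℕ) : ℚ)) * (1 / (2 + (mTr M B : ℚ))) -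
        ((((5 + 1 + 1 : ℕ) : ℚ) + 2) / (((5 + 1 + 1 : ℕ) : ℚ) + 1)) * dem M G 6 B))
    (htwo : ∀ (τ : Finset α) (a a' : α), τ ⊆ gr M → M.eRk (τ : Set α) = ((5 : ℕ) : ℕ∞) → τ.card + 2 = n →
      a ∈ gr M → a' ∈ gr M → a ≠ a' → a ∉ τ → a' ∉ τ → a ∉ M.closure (τ : Set α) → a' ∉ M.closure (τ : Set α) →
      M.eRk ((insert a (insert a' τ) : Finset α) : Set α) = ((5 : ℕ) : ℕ∞) + 1 → 0 ≤ traceHypAddTwoProfile M τ a a' 5 6)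
    (G : Finset α) (hG : G ⊆ gr M) (hrG : M.eRk (G : Set α) = ((5 + 1 : ℕ) : ℕ∞)) (hcard : G.card = n)
    (hmG : mTr M G = 0) :
    0 ≤ ∑ B ∈ Rq M G (5 + 1), ((((5 + 1 + 1 : ℕ) : ℚ) + 2 - ((6 : ℕ) : ℚ)) * (1 / (2 + (mTr M B : ℚ))) -
      ((((5 + 1 + 1 : ℕ) : ℚ) + 2) / (((5 + 1 + 1 : ℕ) : ℚ) + 1)) * dem M G 6 B) :=
  traceSum_succ_of_two_pieces (q := 5) (n := n) (t := 6) (by norm_num) (by norm_num) hcert htwo G hG hrG hcard hmG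

end PercRepro.GenQ
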